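import Summits.CriticalPhenomena.PercolationContinuityZ3.Theorems.PercNearOneGluingNoHeavyPcintUFibStep
import HarnessLib

/-!
# PCINT lane, T-fibre route PHASE 2, step (3U): the usable-set fibre process dominates `π_s` step-wise

Cell `prim-pcint`, seat `prim-pcint-1` (gen 12); memo `run/shared/lean/prim/pcint/T-FIBRE-ROUTE.md` (PHASE 2).

**Theorem (`UFib.dominating`).**  On every finite `Λ ⊆ 𝕋` with root `o`, the usable-set oracle `UFib.outU υ` (root rule
"fibre of `o` all-open", then "the examined fibre meets the usable set of the selected site"), run with the cluster
exploration `ClusterExpl.rule`, under the product prior `π_p^{⊗(Λ × Φ)}` CONDITIONED on the root fibre being all-open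
(`muU`), is step-wise dominating for `π_s` (`AdaptDom.Dominating`), provided

* `s ≤ 1 - (1-p)^{#Φ}` (the root's children: a product law with these marginals), and
* the TAIL TABLE holds for every type `H ⊆ Φ`, every `k ≤ 5` and `1 ≤ j ≤ k`:
  `(Σ_x π_p(x)[meetsU x H]) · P(Bin(k,s) ≥ j) ≤ Σ_x π_p(x)[meetsU x H] · P(Bin(k, 1-(1-p)^{#υ x H}) ≥ j)`
  (the other steps: fibre factorisation `UFib.fibU_mixG_iff`, resampling of the parent fibre `UFib.sum_pw_meetsU_pattern`,
  count dominance `AdaptDom.mixture_dominates_of_tails`; a non-root parent has at most `5` children, `TFib.StepF.card_C_le`).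

This discharges hypothesis `hdom` of `AdaptDom.expect_le_of_dominating` for every usable-set rule `υ`; the tables for the
complete bipartite fibres `K_{n,n}` are closed forms (`…PcintUFibKnn*.lean`).
-/

noncomputable section

namespace Summit.CriticalPhenomena.PercolationContinuityZ3.Theorems.Pcint

namespace UFib

open Finset AdaptDom ClusterExpl TFib Literature.Probability.Percolation Literature.Probability.LatticeModels

variable {Φ : Type*} [Fintype Φ] [DecidableEq Φ]
variable (υ : (Φ → Bool) → Finset Φ → Finset Φ) {Λ : Finset (Site 2)} (enc : ↥Λ → ℕ) (o : ↥Λ) (p : ℝ)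

/-! ### The weight: product prior conditioned on the root fibre being all-open -/

/-- **The weight of the usable-set route**: the product prior `π_p` on fibre states, conditioned on the fibre of the root
being all-open. -/
def muU (w : ↥Λ → (Φ → Bool)) : ℝ :=
  pw (fun _ => wt p) w * (if w o = uAll then 1 else 0) / wt p (uAll : Φ → Bool)

omit [DecidableEq Φ] in
/-- `π_p(uAll) = p^{#Φ}`. -/
theorem wt_uAll : wt p (uAll : Φ → Bool) = p ^ Fintype.card Φ := by
  unfold wt uAll bern
  simp only [if_true, prod_const, card_univ]

variable {o p}

omit [DecidableEq Φ] in
/-- `π_p(uAll) > 0` for `p > 0`. -/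
theorem wt_uAll_pos (hp : 0 < p) : 0 < wt p (uAll : Φ → Bool) := by rw [wt_uAll]; positivity

omit [DecidableEq Φ] in
/-- `muU ≥ 0`. -/
theorem muU_nonneg (hp0 : 0 ≤ p) (hp1 : p ≤ 1) (hp : 0 < p) (w : ↥Λ → (Φ → Bool)) : 0 ≤ muU o p w :=
  div_nonneg (mul_nonneg (pw_nonneg (fun _ s => wt_nonneg hp0 hp1 s) w) (by split_ifs <;> norm_num))
    (wt_uAll_pos hp).le

/-- `muU` is a probability. -/
theorem sum_muU (hp : 0 < p) : ∑ w : ↥Λ → (Φ → Bool), muU o p w = 1 := by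
  unfold muU
  rw [← Finset.sum_div]
  have h := sum_pw_mul_blind (fun (_ : ↥Λ) => wt p) (fun _ => sum_wt p) o
    (fun x => if x = (uAll : Φ → Bool) then (1 : ℝ) else 0) (fun _ => 1) (fun _ _ => rfl)
  simp only [mul_one] at h
  rw [h, sum_pw (fun _ => sum_wt p), mul_one]
  have : ∑ x : Φ → Bool, wt p x * (if x = uAll then (1 : ℝ) else 0) = wt p (uAll : Φ → Bool) := by
    rw [Finset.sum_eq_single (uAll : Φ → Bool) (fun x _ hx => by rw [if_neg hx, mul_zero]) (by simp)]; simp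
  rw [this, div_self (wt_uAll_pos hp).ne']

omit [DecidableEq Φ] in
/-- `muU ≤ pw / p^{#Φ}`. -/
theorem muU_le_pw (hp0 : 0 ≤ p) (hp1 : p ≤ 1) (hp : 0 < p) (w : ↥Λ → (Φ → Bool)) :
    muU o p w ≤ pw (fun _ => wt p) w / wt p (uAll : Φ → Bool) := by
  unfold muU
  refine div_le_div_of_nonneg_right ?_ (wt_uAll_pos hp).le
  have h0 : 0 ≤ pw (fun _ => wt p) w := pw_nonneg (fun _ s => wt_nonneg hp0 hp1 s) w
  split_ifs <;> nlinarith

omit [DecidableEq Φ] in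
variable (o) in
/-- On the fibre of a state of step `n ≥ 1`, the root factor of `muU` is the constant `[σ o = tt]`. -/
theorem root_factor_of_fibU {n : ℕ} (hn : 0 < n) {σ : ↥Λ → Option Bool} {w : ↥Λ → (Φ → Bool)}
    (h : FibU υ enc o n σ w) :
    (if w o = uAll then (1 : ℝ) else 0) = if (σ o).getD false = true then 1 else 0 := by
  have h0 := h 0 hn o (root_mem_rule_zero enc o σ)
  rw [outU_init w (show ∀ v, traj enc o σ 0 v = none from fun _ => rfl)] at h0
  by_cases hw : w o = uAll
  · rw [if_pos hw, if_pos]; rw [← h0]; exact decide_eq_true hw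
  · rw [if_neg hw, if_neg]; rw [← h0]; simp [hw]

open Classical in
variable (o) in
/-- Fibre sums of `muU` at a step `n ≥ 1`: the root factor is constant on the fibre. -/
theorem sum_fibU_muU {n : ℕ} (hn : 0 < n) {σ : ↥Λ → Option Bool} (hcons : traj enc o σ n = σ)
    (F : (↥Λ → (Φ → Bool)) → ℝ) :
    ∑ w ∈ univ.filter (fun w => run (rule (boxGraphT Λ) enc o) (outU υ Λ enc o w) n = σ), muU o p w * F w =
      (if (σ o).getD false = true then (1 : ℝ) else 0) / wt p (uAll : Φ → Bool) *
        ∑ w, pw (fun _ => wt p) w * ((if FibU υ enc o n σ w then (1 : ℝ) else 0) * F w) := by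
  classical
  rw [Finset.sum_filter, Finset.mul_sum]
  refine Finset.sum_congr rfl fun w _ => ?_
  by_cases h : FibU υ enc o n σ w
  · rw [if_pos ((run_eq_iff_fibU υ enc o n σ w).2 ⟨hcons, h⟩), if_pos h, muU, root_factor_of_fibU υ enc o hn h]; ring
  · rw [if_neg (fun h' => h ((run_eq_iff_fibU υ enc o n σ w).1 h').2), if_neg h]; ring

/-! ### The theorem -/

/-- **The usable-set fibre process dominates `π_s` step-wise** (hypothesis `hdom` of `AdaptDom.expect_le_of_dominating`),
given the root marginal inequality and the tail table of the usable-set rule `υ`. -/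
theorem dominating (hp0 : 0 < p) (hp1 : p ≤ 1) {s : ℝ} (hs0 : 0 ≤ s) (hs1 : s ≤ 1)
    (hroot : s ≤ 1 - (1 - p) ^ Fintype.card Φ)
    (htable : ∀ (H : Finset Φ) (k : ℕ), k ≤ 5 → ∀ j, 1 ≤ j → j ≤ k →
      (∑ x : Φ → Bool, wt p x * (if meetsU x H = true then (1 : ℝ) else 0)) * binTail k s j ≤
        ∑ x : Φ → Bool, wt p x * (if meetsU x H = true then (1 : ℝ) else 0) * binTail k (1 - (1 - p) ^ (υ x H).card) j) :
    Dominating s (rule (boxGraphT Λ) enc o) (muU o p) (outU υ Λ enc o) := by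
  classical
  have hp0' : 0 ≤ p := hp0.le
  intro n σ g hg
  have hwt1 : ∑ ω : ↥Λ → Bool, wt s ω = 1 := sum_wt _
  rcases Nat.eq_zero_or_pos n with rfl | hn
  · -- the root step
    by_cases hσ : σ = fun _ => none
    · subst hσ
      have hR : rule (boxGraphT Λ) enc o (fun _ => none) = {o} := by rw [rule, if_pos (fun _ => rfl)]
      have hfib : (univ.filter fun w : ↥Λ → (Φ → Bool) =>
          run (rule (boxGraphT Λ) enc o) (outU υ Λ enc o w) 0 = fun _ => none) = univ := by ext w; simp [run]
      rw [hfib, sum_muU hp0, one_mul]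
      have hle : ∀ ω : ↥Λ → Bool, g ω ≤ g (fun _ => true) := fun ω => hg.1 _ _ fun v _ => Bool.le_true _
      have hval : ∀ w : ↥Λ → (Φ → Bool), muU o p w * g (outU υ Λ enc o w (fun _ => none)) =
          muU o p w * g (fun _ => true) := by
        intro w
        by_cases hw : w o = uAll
        · refine congrArg _ (hg.2 _ _ fun v hv => ?_)
          rw [hR, Finset.mem_singleton] at hv; subst hv
          rw [outU_init w (fun _ => rfl)]; exact decide_eq_true hw
        · simp [muU, hw]
      rw [Finset.sum_congr rfl fun w _ => hval w, ← Finset.sum_mul, sum_muU hp0, one_mul]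
      calc ∑ ω : ↥Λ → Bool, wt s ω * g ω ≤ ∑ ω : ↥Λ → Bool, wt s ω * g (fun _ => true) :=
            Finset.sum_le_sum fun ω _ => mul_le_mul_of_nonneg_left (hle ω) (wt_nonneg hs0 hs1 ω)
        _ = g (fun _ => true) := by rw [← Finset.sum_mul, hwt1, one_mul]
    · have hfib : (univ.filter fun w : ↥Λ → (Φ → Bool) =>
          run (rule (boxGraphT Λ) enc o) (outU υ Λ enc o w) 0 = σ) = ∅ := by
        ext w; simp only [Finset.mem_filter, Finset.mem_univ, true_and, Finset.notMem_empty, iff_false]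
        exact fun h => hσ (h ▸ rfl)
      rw [hfib]; simp
  -- a genuine step
  by_cases hcons : traj enc o σ n = σ
  swap
  · have hfib : (univ.filter fun w : ↥Λ → (Φ → Bool) =>
        run (rule (boxGraphT Λ) enc o) (outU υ Λ enc o w) n = σ) = ∅ := by
      ext w; simp only [Finset.mem_filter, Finset.mem_univ, true_and, Finset.notMem_empty, iff_false]
      exact fun h => hcons ((run_eq_iff_fibU υ enc o n σ w).1 h).1
    rw [hfib]; simp
  have hne : ¬ ∀ v, σ v = none := by
    obtain ⟨n', rfl⟩ := Nat.exists_eq_add_of_le' hn; rw [← hcons]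
    exact not_initial_run_succ (boxGraphT Λ) enc o (readOut σ) n'
  rw [show (∑ w ∈ univ.filter (fun w => run (rule (boxGraphT Λ) enc o) (outU υ Λ enc o w) n = σ), muU o p w) =
      ∑ w ∈ univ.filter (fun w => run (rule (boxGraphT Λ) enc o) (outU υ Λ enc o w) n = σ), muU o p w * 1 by
    simp only [mul_one]]
  rw [sum_fibU_muU υ enc o hn hcons (fun _ => 1), sum_fibU_muU υ enc o hn hcons]
  simp only [mul_one]
  rw [mul_assoc]
  refine mul_le_mul_of_nonneg_left ?_ (div_nonneg (by split_ifs <;> norm_num) (wt_uAll_pos hp0).le)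
  cases hsel : sel (boxGraphT Λ) enc σ with
  | none =>
    have hR := rule_eq_empty_of_sel_eq_none (boxGraphT Λ) enc o hne hsel
    have hc : ∀ x : ↥Λ → Bool, g x = g (fun _ => false) := fun x => hg.2 _ _ fun v hv => by
      rw [hR] at hv; exact absurd hv (by simp)
    have e1 : ∑ ω : ↥Λ → Bool, wt s ω * g ω = g (fun _ => false) := by
      rw [Finset.sum_congr rfl fun ω _ => by rw [hc ω], ← Finset.sum_mul, hwt1, one_mul]
    rw [e1, Finset.sum_mul]
    refine le_of_eq (Finset.sum_congr rfl fun w _ => ?_)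
    rw [hc (outU υ Λ enc o w σ)]; ring
  | some c =>
    by_cases hco : c = o
    · -- the origin step: product law with marginals `1 - (1-p)^{#Φ} ≥ s`
      rw [hco] at hsel
      set W := insert o (rule (boxGraphT Λ) enc o σ)
      have hK : ∀ u w : ↥Λ → (Φ → Bool), u o = uAll → g (outU υ Λ enc o (mixG W u w) σ) =
          g (fun a => if a ∈ rule (boxGraphT Λ) enc o σ then meetsU (u a) (Finset.univ : Finset Φ) else false) :=
        fun u w _ => outU_origin_mixG_children υ hsel hcons u w hg
      refine dominance_of_factorisation (fun _ => wt p) (fun _ => sum_wt p) (fun _ x => wt_nonneg hp0' hp1 x) W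
        (FibU υ enc o n σ) _ (fun u _ => u o = uAll) (fibU_origin_mixG_iff υ hcons hsel) _ _ hK _ fun w => ?_
      -- integrate out the root coordinate
      have hoC : o ∉ rule (boxGraphT Λ) enc o σ := fun h =>
        absurd (rule_unrevealed (boxGraphT Λ) enc o σ o h) (by rw [(sel_revealedTrue (boxGraphT Λ) enc hsel).1]; simp)
      have hblind : ∀ (u : ↥Λ → (Φ → Bool)) (x : Φ → Bool),
          g (fun a => if a ∈ rule (boxGraphT Λ) enc o σ then meetsU (Function.update u o x a) (Finset.univ : Finset Φ) else false) =
          g (fun a => if a ∈ rule (boxGraphT Λ) enc o σ then meetsU (u a) (Finset.univ : Finset Φ) else false) := by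
        intro u x
        refine hg.2 _ _ fun a ha => ?_
        have hao : a ≠ o := fun h => hoC (h ▸ ha)
        rw [Function.update_of_ne hao]
      have h1 := sum_pw_mul_blind (fun (_ : ↥Λ) => wt p) (fun _ => sum_wt p) o
        (fun x => if x = (uAll : Φ → Bool) then (1 : ℝ) else 0)
        (fun u => g (fun a => if a ∈ rule (boxGraphT Λ) enc o σ then meetsU (u a) (Finset.univ : Finset Φ) else false)) hblind
      have h2 := sum_pw_mul_blind (fun (_ : ↥Λ) => wt p) (fun _ => sum_wt p) o
        (fun x => if x = (uAll : Φ → Bool) then (1 : ℝ) else 0) (fun _ => (1 : ℝ)) (fun _ _ => rfl)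
      simp only [mul_one] at h2
      rw [h1, h2, sum_pw (fun _ => sum_wt p), mul_one]
      refine mul_le_mul_of_nonneg_left ?_ (Finset.sum_nonneg fun x _ =>
        mul_nonneg (wt_nonneg hp0' hp1 x) (by split_ifs <;> norm_num))
      refine sum_wt_le_sum_pw_pat (wt p) (fun x => wt_nonneg hp0' hp1 x) (sum_wt p) hs0 hs1
        (fun _ x => meetsU x (Finset.univ : Finset Φ)) _ (fun a _ => ?_) g hg
      rw [sum_wt_filter_meetsU p (Finset.univ : Finset Φ), Finset.card_univ]
      exact hroot
    · -- a general step: the examiner `d` of `c`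
      have hcn : traj enc o σ n c ≠ none := by
        rw [hcons, (sel_revealedTrue (boxGraphT Λ) enc hsel).1]; simp
      obtain ⟨k₀, hk₀, d, hne₀, hseld, -, hcR, -⟩ := exists_examiner (boxGraphT Λ) enc o (readOut σ) hcn hco
      let X : StepF (Λ := Λ) enc o 1 := ⟨n, σ, c, k₀, d, hcons, hsel, hco, hk₀, hne₀, hseld, hcR⟩
      refine dominance_of_factorisation₂ (fun _ => wt p) (fun _ => sum_wt p) (fun _ x => wt_nonneg hp0' hp1 x) X.W₀
        (FibU υ enc o n σ) (FibRestU υ X) (fun u w => meetsU (u X.c) (H υ X w) = true) (fibU_mixG_iff υ X) _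
        (fun u w => g (fun a => if a ∈ X.C then meetsU (u a) (υ (u X.c) (H υ X w)) else false))
        (fun u w _ => outU_mixG_children υ X u w hg) _ fun w => ?_
      have hcC : X.c ∉ X.C := fun h => absurd (X.mem_C h).1 (by rw [X.σ_c]; simp)
      rw [sum_pw_meetsU p (H υ X w) X.c, sum_pw_meetsU_pattern υ p (H υ X w) X.c X.C hcC hg]
      have hk5 : X.C.card ≤ 5 := X.card_C_le
      exact mixture_dominates_of_tails (X := Φ → Bool) X.C
        (fun x => wt p x * (if meetsU x (H υ X w) = true then (1 : ℝ) else 0))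
        (fun x => 1 - (1 - p) ^ (υ x (H υ X w)).card) s
        (fun j hj1 hjk => htable (H υ X w) X.C.card hk5 j hj1 hjk) hg

end UFib

end Summit.CriticalPhenomena.PercolationContinuityZ3.Theorems.Pcint

end
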